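import Mathlib
import HarnessLib
import Summits.ValiantsHypothesis.ValiantsHypothesis.Theorems.KPlusLogSqLawWeakLiftingTowerGraftWronskianDevelopable

/-!
# Tower graft line — CONJECTURE W HOLDS FOR EVERY PENCIL THROUGH A BINOMIAL (all `K`, all supports), and `≤ K − 2` through a monomial

Helper file for LINE (B) `Cruxes/WeakLifting/Lines/tower_graft.lean` (crux `WeakLifting` = stmt-ValiantsHypothesis-19561), on hand g9's
CONJECTURE W «`Z₊(W(u,v)) ≤ 2K − 4` for two real `K`-nomials on a common support» (= the `k = 1` developable conjecture of
[cite: SedykhShapiro2005] on lacunary moment arcs, `…WronskianDevelopable`).  NO stub is claimed; the general case stays open.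

THE BINOMIAL CHAMBER (`card_posRoots_wronskian_le_of_binomial`).  If `u` is a BINOMIAL on the support (`uₗ = 0` off two classes
`i, j`) and `v` is ANY `K`-nomial on it, then `Z₊(W(u,v)) ≤ 2K − 4`.  Reason (`support_X_mul_wronskian_subset_of_binomial`): in the
Plücker pair-sum form `X·W = Σ_{a<b} p_{ab}(d_b − dₐ)X^{dₐ+d_b}` only the `2K − 3` pairs MEETING `{i, j}` survive, so `X·W(u,v)` has at most
`2K − 3` monomials and Descartes gives `2K − 4` — the conjectured bound, on every support, with no tropical or positivity input.  By the
GL₂-invariance of `…WronskianDevelopable` (`roots_wronskian_pencil_pencil`) the same holds whenever SOME member `αu + βv ≠ 0` of the pencil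
is a binomial (`card_posRoots_wronskian_le_of_pencil_binomial`): geometrically (developable dictionary), the common kernel
`ker u ∩ ker v` together with the coordinate subspace `span{e_l : l ≠ i, j}` spans at most a hyperplane of `ℝ^K`.  Through a
MONOMIAL the count drops to `K − 2` (`card_posRoots_wronskian_le_of_monomial`; `W(X^{dᵢ}, v)` is `X^{dᵢ−1}` times a `(K−1)`-nomial).
A trinomial member only gives `3K − 7` (weaker than `2K − 4` from `K = 4` on), so the binomial chamber is where this mechanism stops;
the first open case remains two GENERIC `4`-nomials on an unbalanced support (`…WronskianTowerWitness`: `4 ≤ Z₊ ≤ 5` on `(0,1,3,20)`).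

HONEST FRAMING: Descartes bookkeeping on the pair-sum form; Conjecture W in general, S4/S4b/S4d/S4f/S5/S5ᴸ, TowerB, `WeakLifting`,
Conjecture B, `MatrixDescartes` (18050), `VP ≠ VNP`: untouched.  Def-free.  Seat: prover leafhand-val-kpluslogsqlaw-1 g10,
`--supports stmt-ValiantsHypothesis-19561 --as helper`.  [folklore: Descartes' rule; the chamber statements are this work]
-/

-- `Summit.ValiantsHypothesis.ValiantsHypothesis.…` repeats a component by the D-0017 layout
-- (single-conjunct summit), which the `dupNamespace` linter flags; the name is mandated.
set_option linter.dupNamespace false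
set_option autoImplicit false

namespace Summit.ValiantsHypothesis.ValiantsHypothesis.Theorems.KPlusLogSqLaw.TowerGraft

open Polynomial Finset
open scoped BigOperators Polynomial

namespace WronskianDevelopable

/-- the pair sums through two classes `i, j`: `{dᵢ + d_b : b ≠ i} ∪ {d_j + d_b : b ≠ i, j}` — at most `(K−1) + (K−2) = 2K − 3` of them.
[this work] -/
theorem card_pairSumsThrough_le {K : ℕ} (d : Fin K → ℕ) (i j : Fin K) (hij : i ≠ j) :
    (((Finset.univ.erase i).image (fun b => d i + d b)) ∪
      (((Finset.univ.erase i).erase j).image (fun b => d j + d b))).card ≤ 2 * K - 3 := by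
  have h1 : ((Finset.univ.erase i).image (fun b => d i + d b)).card ≤ K - 1 :=
    Finset.card_image_le.trans (by rw [Finset.card_erase_of_mem (Finset.mem_univ i), Finset.card_univ, Fintype.card_fin])
  have h2 : ((((Finset.univ : Finset (Fin K)).erase i).erase j).image (fun b => d j + d b)).card ≤ K - 2 := by
    refine Finset.card_image_le.trans ?_
    have hj : j ∈ (Finset.univ : Finset (Fin K)).erase i := Finset.mem_erase.mpr ⟨hij.symm, Finset.mem_univ j⟩
    rw [Finset.card_erase_of_mem hj, Finset.card_erase_of_mem (Finset.mem_univ i), Finset.card_univ, Fintype.card_fin]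
    omega
  have hK : 2 ≤ K := by
    rcases Nat.lt_or_ge K 2 with h | h
    · exfalso
      have : Fintype.card (Fin K) ≤ 1 := by rw [Fintype.card_fin]; omega
      exact hij (Fintype.card_le_one_iff.mp this i j)
    · exact h
  refine (Finset.card_union_le _ _).trans ?_
  omega

/-- **the support of `X·W(u,v)` for a BINOMIAL `u`** (`uₗ = 0` off `{i,j}`): only pair sums through `i` or `j` occur. [this work] -/
theorem support_X_mul_wronskian_subset_of_binomial {K : ℕ} (u v : Fin K → ℝ) (d : Fin K → ℕ) (i j : Fin K) (hij : i ≠ j)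
    (hu : ∀ l, l ≠ i → l ≠ j → u l = 0) :
    ((X : ℝ[X]) * wronskian (∑ l, C (u l) * X ^ d l) (∑ l, C (v l) * X ^ d l)).support ⊆
      ((Finset.univ.erase i).image (fun b => d i + d b)) ∪ (((Finset.univ.erase i).erase j).image (fun b => d j + d b)) := by
  intro n hn
  rw [mem_support_iff, InflectionLaw.X_mul_wronskian_fewnomial_eq, finsetSum_coeff] at hn
  simp only [finsetSum_coeff, coeff_C_mul_X_pow] at hn
  by_contra hmem
  apply hn
  refine Finset.sum_eq_zero fun a _ => Finset.sum_eq_zero fun b _ => ?_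
  split_ifs with h
  · by_cases hab : a = b
    · subst hab; simp
    by_cases hua : u a = 0
    · rw [hua]; simp
    -- `u a ≠ 0` forces `a ∈ {i, j}`
    have ha : a = i ∨ a = j := by
      by_contra hne
      simp only [not_or] at hne
      exact hua (hu a hne.1 hne.2)
    exfalso
    apply hmem
    rw [Finset.mem_union]
    rcases ha with hai | haj
    · refine Or.inl (Finset.mem_image.mpr ⟨b, Finset.mem_erase.mpr ⟨fun hbi => hab (hai.trans hbi.symm), Finset.mem_univ b⟩, ?_⟩)
      rw [← hai]; exact h.symm
    · by_cases hbi : b = i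
      · refine Or.inl (Finset.mem_image.mpr ⟨a, Finset.mem_erase.mpr ⟨fun hai => hij (hai.symm.trans haj), Finset.mem_univ a⟩, ?_⟩)
        rw [h, hbi, add_comm]
      · refine Or.inr (Finset.mem_image.mpr ⟨b, Finset.mem_erase.mpr ⟨fun hbj => hab (haj.trans hbj.symm),
          Finset.mem_erase.mpr ⟨hbi, Finset.mem_univ b⟩⟩, ?_⟩)
        rw [← haj]; exact h.symm
  · rfl

/-- **THE BINOMIAL CHAMBER OF CONJECTURE W.**  `u` a binomial on the support (`uₗ = 0` off two classes `i ≠ j`), `v` any `K`-nomial: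
`Z₊(W(u,v)) ≤ 2K − 4` — on EVERY support. [this work] -/
theorem card_posRoots_wronskian_le_of_binomial {K : ℕ} (u v : Fin K → ℝ) (d : Fin K → ℕ) (i j : Fin K) (hij : i ≠ j)
    (hu : ∀ l, l ≠ i → l ≠ j → u l = 0) :
    ((wronskian (∑ l, C (u l) * X ^ d l) (∑ l, C (v l) * X ^ d l)).roots.toFinset.filter (fun x => 0 < x)).card ≤ 2 * K - 4 := by
  rw [← InflectionLaw.card_posRoots_X_mul]
  refine (LacunarySymmetroidMatrixDescartes.FiniteSector.card_posRoots_le_card_support_sub_one _).trans ?_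
  have h1 := Finset.card_le_card (support_X_mul_wronskian_subset_of_binomial u v d i j hij hu)
  have h2 := card_pairSumsThrough_le d i j hij
  omega

/-- the pair sums through ONE class `i`: at most `K − 1`. [this work] -/
theorem support_X_mul_wronskian_subset_of_monomial {K : ℕ} (u v : Fin K → ℝ) (d : Fin K → ℕ) (i : Fin K)
    (hu : ∀ l, l ≠ i → u l = 0) :
    ((X : ℝ[X]) * wronskian (∑ l, C (u l) * X ^ d l) (∑ l, C (v l) * X ^ d l)).support ⊆
      (Finset.univ.erase i).image (fun b => d i + d b) := by
  intro n hn
  rw [mem_support_iff, InflectionLaw.X_mul_wronskian_fewnomial_eq, finsetSum_coeff] at hn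
  simp only [finsetSum_coeff, coeff_C_mul_X_pow] at hn
  by_contra hmem
  apply hn
  refine Finset.sum_eq_zero fun a _ => Finset.sum_eq_zero fun b _ => ?_
  split_ifs with h
  · by_cases hab : a = b
    · subst hab; simp
    by_cases hua : u a = 0
    · rw [hua]; simp
    have ha : a = i := by by_contra hne; exact hua (hu a hne)
    refine absurd (Finset.mem_image.mpr ⟨b, Finset.mem_erase.mpr ⟨fun hbi => hab (ha.trans hbi.symm), Finset.mem_univ b⟩, ?_⟩) hmem
    rw [← ha]; exact h.symm
  · rfl

/-- **through a MONOMIAL the count is `K − 2`**: `u = uᵢ X^{dᵢ}`, `v` any `K`-nomial ⇒ `Z₊(W(u,v)) ≤ K − 2` (e.g. `W(1, v) = v′`).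
[this work] -/
theorem card_posRoots_wronskian_le_of_monomial {K : ℕ} (u v : Fin K → ℝ) (d : Fin K → ℕ) (i : Fin K)
    (hu : ∀ l, l ≠ i → u l = 0) :
    ((wronskian (∑ l, C (u l) * X ^ d l) (∑ l, C (v l) * X ^ d l)).roots.toFinset.filter (fun x => 0 < x)).card ≤ K - 2 := by
  rw [← InflectionLaw.card_posRoots_X_mul]
  refine (LacunarySymmetroidMatrixDescartes.FiniteSector.card_posRoots_le_card_support_sub_one _).trans ?_
  have h1 := Finset.card_le_card (support_X_mul_wronskian_subset_of_monomial u v d i hu)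
  have h2 : ((Finset.univ.erase i).image (fun b => d i + d b)).card ≤ K - 1 :=
    Finset.card_image_le.trans (by rw [Finset.card_erase_of_mem (Finset.mem_univ i), Finset.card_univ, Fintype.card_fin])
  omega

/-- **PENCIL FORM**: if SOME nonzero member `α·u + β·v` of the pencil is a binomial (supported on `{i, j}`, `i ≠ j`), then
`Z₊(W(u,v)) ≤ 2K − 4` — `Z₊` is an invariant of the plane (`roots_wronskian_pencil_pencil`). [this work] -/
theorem card_posRoots_wronskian_le_of_pencil_binomial {K : ℕ} (u v : Fin K → ℝ) (d : Fin K → ℕ) (i j : Fin K) (hij : i ≠ j)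
    (a b : ℝ) (hab : (a, b) ≠ (0, 0)) (hw : ∀ l, l ≠ i → l ≠ j → a * u l + b * v l = 0) :
    ((wronskian (∑ l, C (u l) * X ^ d l) (∑ l, C (v l) * X ^ d l)).roots.toFinset.filter (fun x => 0 < x)).card ≤ 2 * K - 4 := by
  -- complete `(a, b)` to a unimodular change of basis `w = a u + b v`, `w' = c u + e v` with `a e − b c = 1`
  obtain ⟨c, e, hdet⟩ : ∃ c e : ℝ, a * e - b * c = 1 := by
    by_cases ha : a = 0
    · have hb : b ≠ 0 := by
        intro hb; exact hab (by rw [ha, hb])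
      exact ⟨-1 / b, 0, by field_simp; rw [ha]; ring⟩
    · exact ⟨0, 1 / a, by field_simp; ring⟩
  have hroots := roots_wronskian_pencil_pencil (∑ l, C (u l) * X ^ d l) (∑ l, C (v l) * X ^ d l)
    (a := a) (b := b) (c := c) (d := e) (by rw [hdet]; exact one_ne_zero)
  rw [← hroots, pencil_fewnomial_eq, pencil_fewnomial_eq]
  exact card_posRoots_wronskian_le_of_binomial (fun l => a * u l + b * v l) (fun l => c * u l + e * v l) d i j hij hw

end WronskianDevelopable

end Summit.ValiantsHypothesis.ValiantsHypothesis.Theorems.KPlusLogSqLaw.TowerGraft
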